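import Summits.Ventures.CertifiedManyBodySolver.Downfold.EmeryOrbitalWeightFaceBox
import Summits.Ventures.CertifiedManyBodySolver.Downfold.EmeryVanHoveSubBox
import Summits.Ventures.CertifiedManyBodySolver.Downfold.EmeryVanHoveTableE
import Summits.Ventures.CertifiedManyBodySolver.Downfold.EmeryFermiFacePointsLa214DFTX0125S1
import Summits.Ventures.CertifiedManyBodySolver.Downfold.EmeryFermiFacePointsLa214ALLX0125S1
import Summits.Ventures.CertifiedManyBodySolver.Downfold.EmeryFermiFacePointsLa214DFTX0125S2
import Summits.Ventures.CertifiedManyBodySolver.Downfold.EmeryFermiFacePointsLa214ALLX0125S2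
import Summits.Ventures.CertifiedManyBodySolver.Downfold.EmeryFermiFacePointsLa214DFTX0125S3
import Summits.Ventures.CertifiedManyBodySolver.Downfold.EmeryFermiFacePointsLa214ALLX0125S3
import HarnessLib

/-!
# THE ANTINODAL FERMI-SURFACE Cu-d WEIGHT OVER THE TYPED 3BE BOX `emeryBoxLa214v123 ∩ {Δ_pd ∈ [1.7, 2.91]} (DFT-level Δ tag)` AT FILLING x = 1/8 (ν = 7/16) — the kinematic leg of the UPPER member `U_B∣full(w_antinode)` of the weak
# band-level `U` bracket read over a box (INFL-3to1-B §B.90; kernel `EmeryOrbitalWeightFaceBox`; router/OBJECT-E-BUDGET.tsv §C)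

Venture CertifiedManyBodySolver, cell `pub/hubbard-downfold` (stage S1), seat hubbard-downfold-mod-4 (technique B, g38); namespace
`Summit.Ventures.CertifiedManyBodySolver.Downfold.Emery`. Everything PROVED (0 sorry). WHAT THIS IS NOT: a statement about the material — the typed box (La₂₋ₓSrₓCuO₄ box #18 — DFT-LEVEL Δ_pd members [1.7, 2.91] (§OF-RECORD v1.2 level tag))
is SCREENING-GRADE; `U = 0` one-body kinematics of the σ model; the `U_B` arithmetic that consumes the window is DERIVED context on the MEAN-FIELD annex (R-B17).

For every member θ = (Δ, t_pd, t_pp, t_pp′) ∈ [1.7, 2.91] × [1.29, 1.52] × [0.46, 0.66] × [0.12, 0.15] eV at filling ν = 7/16, the Cu-d weight of the ANTINODAL Bloch state (the zone-face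
point of the member's own Fermi surface — the MOST Cu-like Fermi point, `EmeryOrbitalWeightMonotone`), `dWeightFace θ (fermiEnergyOf θ ν)`, lies in the window below.
DEVICE: `W(θ) = W(Δ/t_pd, 1, t_pp/t_pd, t_pp′/t_pd)` (scaling law); the t_pd range is cut into 3 slabs; on each normalised slab the THREE-COORDINATE CORNER RULE
`dWeightFace_fermiEnergyOf_mem_Icc_of_mem_box3_num` (levers Δ ↑, t_pp ↓, t_pp′ ↑ at fixed filling; hole-likeness from the slab's `vhBoxCheck` + the Ψ table; the upper
face edge from four corner inequalities; the antinodal charge-transfer regime `4(t_pp + t_pp′) ≤ Δ + ε_F` at two corners) is read on three K = 384 Fermi-energy brackets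
(`EmeryFermiFacePointsLa214DFTX0125S<k>`). The slab corners `(Δ₂/a₁, 1, b₁/a₂, c₂/a₁)` are VIRTUAL (not members): the window is a sound ENCLOSURE, a few 10⁻³ wider than the image.

| t_pd slab (eV) | normalised slab Δ/t_pd × t_pp/t_pd × t_pp′/t_pd | q₁ (vhBoxCheck) ≥ table point | E_h | E_R | E_v | regime margins (R1, R2) | **w_face window** |
|---|---|---|---|---|---|---|---|
| [1.29, 1.37] | [1.241, 2.256] × [0.3358, 0.5116] × [0.08759, 0.1163] | 0.3177 ≥ 57/200 (Ψ ≤ 0.4261) | 1.4601 | 1.3661 | 1.0765 | +0.095, +1.524 | **[0.6554, 0.7767]** |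
| [1.37, 1.45] | [1.172, 2.124] × [0.3172, 0.4818] × [0.08276, 0.1095] | 0.3075 ≥ 57/200 (Ψ ≤ 0.4261) | 1.4803 | 1.391 | 1.1108 | +0.198, +1.528 | **[0.6493, 0.7656]** |
| [1.45, 1.52] | [1.118, 2.007] × [0.3026, 0.4552] × [0.07895, 0.1034] | 0.3000 ≥ 57/200 (Ψ ≤ 0.4261) | 1.4948 | 1.4118 | 1.1426 | +0.296, +1.525 | **[0.6449, 0.7552]** |
| **whole box** | (hull of the slabs) | | | | | | **[0.6449, 0.7767]** |

Sources: three-band model [HybertsenSchluterChristensen1989, Eq. (1)]; face point of the bilinear contour [AndersenEtAl1995, §6]; [folklore] algebra.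
-/

noncomputable section

namespace Summit.Ventures.CertifiedManyBodySolver.Downfold.Emery

open Real Set

/-- **Slab 1 (t_pd ∈ [1.29, 1.37] eV) of `emeryBoxLa214v123 ∩ {Δ_pd ∈ [1.7, 2.91]} (DFT-level Δ tag)`, ν = 7/16: the antinodal Fermi-surface Cu-d weight of every member lies in `[0.6554, 0.7767]`**
(normalised-slab corner rule; brackets `facePt_La214ALL_x0125_s1_lo_br` / `_R_br` / `_hi_br`). [folklore] -/
theorem la214DFTBox_dWeightFace_x0125_s1 {Δ a b c : ℝ} (hΔ : Δ ∈ Icc ((17 : ℝ) / 10) ((291 : ℝ) / 100)) (ha : a ∈ Icc ((129 : ℝ) / 100) ((137 : ℝ) / 100)) (hb : b ∈ Icc ((23 : ℝ) / 50) ((33 : ℝ) / 50)) (hc : c ∈ Icc ((3 : ℝ) / 25) ((3 : ℝ) / 20)) :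
    dWeightFace Δ a b c (fermiEnergyOf Δ a b c ((7 : ℝ) / 16)) ∈ Icc ((3277 : ℝ) / 5000) ((7767 : ℝ) / 10000) := by
  have ha0 : 0 < a := lt_of_lt_of_le (by norm_num) ha.1
  rw [dWeightFace_fermiEnergyOf_eq_ratios ha0]
  have hΔn : Δ / a ∈ Icc ((170 : ℝ) / 137) ((97 : ℝ) / 43) := by
    constructor
    · rw [le_div_iff₀ ha0]; linarith [hΔ.1, ha.2]
    · rw [div_le_iff₀ ha0]; linarith [hΔ.2, ha.1]
  have hbn : b / a ∈ Icc ((46 : ℝ) / 137) ((22 : ℝ) / 43) := by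
    constructor
    · rw [le_div_iff₀ ha0]; linarith [hb.1, ha.2]
    · rw [div_le_iff₀ ha0]; linarith [hb.2, ha.1]
  have hcn : c / a ∈ Icc ((12 : ℝ) / 137) ((5 : ℝ) / 43) := by
    constructor
    · rw [le_div_iff₀ ha0]; linarith [hc.1, ha.2]
    · rw [div_le_iff₀ ha0]; linarith [hc.2, ha.1]
  have hVH : ∀ Δ' b' c' : ℝ, Δ' ∈ Icc ((170 : ℝ) / 137) ((97 : ℝ) / 43) → b' ∈ Icc ((46 : ℝ) / 137) ((22 : ℝ) / 43) → c' ∈ Icc ((12 : ℝ) / 137) ((5 : ℝ) / 43) →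
      1 - 2 * ((7 : ℝ) / 16) ≤ xVH Δ' 1 b' c' := by
    intro Δ' b' c' hΔ' hb' hc'
    have h := xVH_window_of_vhBoxCheck (Δ₁ := ((170 : ℚ) / 137)) (Δ₂ := ((97 : ℚ) / 43)) (a₁ := (1 : ℚ)) (a₂ := (1 : ℚ)) (b₁ := ((46 : ℚ) / 137)) (b₂ := ((22 : ℚ) / 43))
      (c₁ := ((12 : ℚ) / 137)) (c₂ := ((5 : ℚ) / 43)) (v₁ := ((10583 : ℚ) / 10000)) (v₂ := ((13569 : ℚ) / 10000)) (e := ((13213 : ℚ) / 10000)) (E := ((271 : ℚ) / 250))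
      (q₁ := ((3177 : ℚ) / 10000)) (q₂ := ((913 : ℚ) / 1250)) (by decide +kernel)
      (Δ := Δ') (tpd := 1) (tpp := b') (c := c') (by simpa using hΔ') (by simp) (by simpa using hb') (by simpa using hc')
    obtain ⟨-, -, -, -, -, hwin⟩ := h
    push_cast at hwin
    have ht := vhFrac_57_200
    have hmono := vhFrac_anti (show (57 / 200 : ℝ) ≤ ((3177 : ℝ) / 10000) by norm_num)
    have hnu : ((62833 : ℝ) / 147456) ≤ ((7 : ℝ) / 16) := by norm_num
    linarith [hwin.1, ht.2]
  have hEh := (fermiEnergyOf_of_pointBracketCheck facePt_La214ALL_x0125_s1_lo_br (by norm_num) (by norm_num) (by norm_num) (ν := (7/16 : ℝ))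
    (by push_cast; exact ⟨le_rfl, le_rfl⟩)).2
  have hER := (fermiEnergyOf_of_pointBracketCheck facePt_La214ALL_x0125_s1_R_br (by norm_num) (by norm_num) (by norm_num) (ν := (7/16 : ℝ))
    (by push_cast; exact ⟨le_rfl, le_rfl⟩)).2
  have hEv := (fermiEnergyOf_of_pointBracketCheck facePt_La214DFT_x0125_s1_hi_br (by norm_num) (by norm_num) (by norm_num) (ν := (7/16 : ℝ))
    (by push_cast; exact ⟨le_rfl, le_rfl⟩)).2
  push_cast at hEh hER hEv
  exact dWeightFace_fermiEnergyOf_mem_Icc_of_mem_box3_num (Eh := ((14601 : ℝ) / 10000)) (ER := ((13661 : ℝ) / 10000)) (Ev := ((2153 : ℝ) / 2000))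
    (by norm_num) one_pos (by norm_num) (by norm_num) hΔn hbn hcn (by norm_num) (by norm_num) hVH hEh.2 (by norm_num)
    (by norm_num [faceU, fsD, fsN, cA]) (by norm_num [faceU, fsD, fsN, cA]) (by norm_num [faceU, fsD, fsN, cA]) (by norm_num [faceU, fsD, fsN, cA])
    hER.1 (by norm_num) hEv.1 (by norm_num) (by norm_num) (by norm_num [faceG])
    (by norm_num [dWeightFaceCF, faceN, faceR, fsN]) (by norm_num [dWeightFaceCF, faceN, faceR, fsN])

/-- **Slab 2 (t_pd ∈ [1.37, 1.45] eV) of `emeryBoxLa214v123 ∩ {Δ_pd ∈ [1.7, 2.91]} (DFT-level Δ tag)`, ν = 7/16: the antinodal Fermi-surface Cu-d weight of every member lies in `[0.6493, 0.7656]`**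
(normalised-slab corner rule; brackets `facePt_La214ALL_x0125_s2_lo_br` / `_R_br` / `_hi_br`). [folklore] -/
theorem la214DFTBox_dWeightFace_x0125_s2 {Δ a b c : ℝ} (hΔ : Δ ∈ Icc ((17 : ℝ) / 10) ((291 : ℝ) / 100)) (ha : a ∈ Icc ((137 : ℝ) / 100) ((29 : ℝ) / 20)) (hb : b ∈ Icc ((23 : ℝ) / 50) ((33 : ℝ) / 50)) (hc : c ∈ Icc ((3 : ℝ) / 25) ((3 : ℝ) / 20)) :
    dWeightFace Δ a b c (fermiEnergyOf Δ a b c ((7 : ℝ) / 16)) ∈ Icc ((6493 : ℝ) / 10000) ((957 : ℝ) / 1250) := by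
  have ha0 : 0 < a := lt_of_lt_of_le (by norm_num) ha.1
  rw [dWeightFace_fermiEnergyOf_eq_ratios ha0]
  have hΔn : Δ / a ∈ Icc ((34 : ℝ) / 29) ((291 : ℝ) / 137) := by
    constructor
    · rw [le_div_iff₀ ha0]; linarith [hΔ.1, ha.2]
    · rw [div_le_iff₀ ha0]; linarith [hΔ.2, ha.1]
  have hbn : b / a ∈ Icc ((46 : ℝ) / 145) ((66 : ℝ) / 137) := by
    constructor
    · rw [le_div_iff₀ ha0]; linarith [hb.1, ha.2]
    · rw [div_le_iff₀ ha0]; linarith [hb.2, ha.1]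
  have hcn : c / a ∈ Icc ((12 : ℝ) / 145) ((15 : ℝ) / 137) := by
    constructor
    · rw [le_div_iff₀ ha0]; linarith [hc.1, ha.2]
    · rw [div_le_iff₀ ha0]; linarith [hc.2, ha.1]
  have hVH : ∀ Δ' b' c' : ℝ, Δ' ∈ Icc ((34 : ℝ) / 29) ((291 : ℝ) / 137) → b' ∈ Icc ((46 : ℝ) / 145) ((66 : ℝ) / 137) → c' ∈ Icc ((12 : ℝ) / 145) ((15 : ℝ) / 137) →
      1 - 2 * ((7 : ℝ) / 16) ≤ xVH Δ' 1 b' c' := by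
    intro Δ' b' c' hΔ' hb' hc'
    have h := xVH_window_of_vhBoxCheck (Δ₁ := ((34 : ℚ) / 29)) (Δ₂ := ((291 : ℚ) / 137)) (a₁ := (1 : ℚ)) (a₂ := (1 : ℚ)) (b₁ := ((46 : ℚ) / 145)) (b₂ := ((66 : ℚ) / 137))
      (c₁ := ((12 : ℚ) / 145)) (c₂ := ((15 : ℚ) / 137)) (v₁ := ((547 : ℚ) / 500)) (v₂ := ((13849 : ℚ) / 10000)) (e := ((3377 : ℚ) / 2500)) (E := ((1399 : ℚ) / 1250))
      (q₁ := ((123 : ℚ) / 400)) (q₂ := ((6883 : ℚ) / 10000)) (by decide +kernel)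
      (Δ := Δ') (tpd := 1) (tpp := b') (c := c') (by simpa using hΔ') (by simp) (by simpa using hb') (by simpa using hc')
    obtain ⟨-, -, -, -, -, hwin⟩ := h
    push_cast at hwin
    have ht := vhFrac_57_200
    have hmono := vhFrac_anti (show (57 / 200 : ℝ) ≤ ((123 : ℝ) / 400) by norm_num)
    have hnu : ((62833 : ℝ) / 147456) ≤ ((7 : ℝ) / 16) := by norm_num
    linarith [hwin.1, ht.2]
  have hEh := (fermiEnergyOf_of_pointBracketCheck facePt_La214ALL_x0125_s2_lo_br (by norm_num) (by norm_num) (by norm_num) (ν := (7/16 : ℝ))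
    (by push_cast; exact ⟨le_rfl, le_rfl⟩)).2
  have hER := (fermiEnergyOf_of_pointBracketCheck facePt_La214ALL_x0125_s2_R_br (by norm_num) (by norm_num) (by norm_num) (ν := (7/16 : ℝ))
    (by push_cast; exact ⟨le_rfl, le_rfl⟩)).2
  have hEv := (fermiEnergyOf_of_pointBracketCheck facePt_La214DFT_x0125_s2_hi_br (by norm_num) (by norm_num) (by norm_num) (ν := (7/16 : ℝ))
    (by push_cast; exact ⟨le_rfl, le_rfl⟩)).2
  push_cast at hEh hER hEv
  exact dWeightFace_fermiEnergyOf_mem_Icc_of_mem_box3_num (Eh := ((14803 : ℝ) / 10000)) (ER := ((1391 : ℝ) / 1000)) (Ev := ((2777 : ℝ) / 2500))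
    (by norm_num) one_pos (by norm_num) (by norm_num) hΔn hbn hcn (by norm_num) (by norm_num) hVH hEh.2 (by norm_num)
    (by norm_num [faceU, fsD, fsN, cA]) (by norm_num [faceU, fsD, fsN, cA]) (by norm_num [faceU, fsD, fsN, cA]) (by norm_num [faceU, fsD, fsN, cA])
    hER.1 (by norm_num) hEv.1 (by norm_num) (by norm_num) (by norm_num [faceG])
    (by norm_num [dWeightFaceCF, faceN, faceR, fsN]) (by norm_num [dWeightFaceCF, faceN, faceR, fsN])

/-- **Slab 3 (t_pd ∈ [1.45, 1.52] eV) of `emeryBoxLa214v123 ∩ {Δ_pd ∈ [1.7, 2.91]} (DFT-level Δ tag)`, ν = 7/16: the antinodal Fermi-surface Cu-d weight of every member lies in `[0.6449, 0.7552]`**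
(normalised-slab corner rule; brackets `facePt_La214ALL_x0125_s3_lo_br` / `_R_br` / `_hi_br`). [folklore] -/
theorem la214DFTBox_dWeightFace_x0125_s3 {Δ a b c : ℝ} (hΔ : Δ ∈ Icc ((17 : ℝ) / 10) ((291 : ℝ) / 100)) (ha : a ∈ Icc ((29 : ℝ) / 20) ((38 : ℝ) / 25)) (hb : b ∈ Icc ((23 : ℝ) / 50) ((33 : ℝ) / 50)) (hc : c ∈ Icc ((3 : ℝ) / 25) ((3 : ℝ) / 20)) :
    dWeightFace Δ a b c (fermiEnergyOf Δ a b c ((7 : ℝ) / 16)) ∈ Icc ((6449 : ℝ) / 10000) ((472 : ℝ) / 625) := by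
  have ha0 : 0 < a := lt_of_lt_of_le (by norm_num) ha.1
  rw [dWeightFace_fermiEnergyOf_eq_ratios ha0]
  have hΔn : Δ / a ∈ Icc ((85 : ℝ) / 76) ((291 : ℝ) / 145) := by
    constructor
    · rw [le_div_iff₀ ha0]; linarith [hΔ.1, ha.2]
    · rw [div_le_iff₀ ha0]; linarith [hΔ.2, ha.1]
  have hbn : b / a ∈ Icc ((23 : ℝ) / 76) ((66 : ℝ) / 145) := by
    constructor
    · rw [le_div_iff₀ ha0]; linarith [hb.1, ha.2]
    · rw [div_le_iff₀ ha0]; linarith [hb.2, ha.1]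
  have hcn : c / a ∈ Icc ((3 : ℝ) / 38) ((3 : ℝ) / 29) := by
    constructor
    · rw [le_div_iff₀ ha0]; linarith [hc.1, ha.2]
    · rw [div_le_iff₀ ha0]; linarith [hc.2, ha.1]
  have hVH : ∀ Δ' b' c' : ℝ, Δ' ∈ Icc ((85 : ℝ) / 76) ((291 : ℝ) / 145) → b' ∈ Icc ((23 : ℝ) / 76) ((66 : ℝ) / 145) → c' ∈ Icc ((3 : ℝ) / 38) ((3 : ℝ) / 29) →
      1 - 2 * ((7 : ℝ) / 16) ≤ xVH Δ' 1 b' c' := by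
    intro Δ' b' c' hΔ' hb' hc'
    have h := xVH_window_of_vhBoxCheck (Δ₁ := ((85 : ℚ) / 76)) (Δ₂ := ((291 : ℚ) / 145)) (a₁ := (1 : ℚ)) (a₂ := (1 : ℚ)) (b₁ := ((23 : ℚ) / 76)) (b₂ := ((66 : ℚ) / 145))
      (c₁ := ((3 : ℚ) / 38)) (c₂ := ((3 : ℚ) / 29)) (v₁ := ((11273 : ℚ) / 10000)) (v₂ := ((3519 : ℚ) / 2500)) (e := ((3439 : ℚ) / 2500)) (E := ((5757 : ℚ) / 5000))
      (q₁ := ((3 : ℚ) / 10)) (q₂ := ((6487 : ℚ) / 10000)) (by decide +kernel)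
      (Δ := Δ') (tpd := 1) (tpp := b') (c := c') (by simpa using hΔ') (by simp) (by simpa using hb') (by simpa using hc')
    obtain ⟨-, -, -, -, -, hwin⟩ := h
    push_cast at hwin
    have ht := vhFrac_57_200
    have hmono := vhFrac_anti (show (57 / 200 : ℝ) ≤ ((3 : ℝ) / 10) by norm_num)
    have hnu : ((62833 : ℝ) / 147456) ≤ ((7 : ℝ) / 16) := by norm_num
    linarith [hwin.1, ht.2]
  have hEh := (fermiEnergyOf_of_pointBracketCheck facePt_La214ALL_x0125_s3_lo_br (by norm_num) (by norm_num) (by norm_num) (ν := (7/16 : ℝ))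
    (by push_cast; exact ⟨le_rfl, le_rfl⟩)).2
  have hER := (fermiEnergyOf_of_pointBracketCheck facePt_La214ALL_x0125_s3_R_br (by norm_num) (by norm_num) (by norm_num) (ν := (7/16 : ℝ))
    (by push_cast; exact ⟨le_rfl, le_rfl⟩)).2
  have hEv := (fermiEnergyOf_of_pointBracketCheck facePt_La214DFT_x0125_s3_hi_br (by norm_num) (by norm_num) (by norm_num) (ν := (7/16 : ℝ))
    (by push_cast; exact ⟨le_rfl, le_rfl⟩)).2
  push_cast at hEh hER hEv
  exact dWeightFace_fermiEnergyOf_mem_Icc_of_mem_box3_num (Eh := ((3737 : ℝ) / 2500)) (ER := ((7059 : ℝ) / 5000)) (Ev := ((5713 : ℝ) / 5000))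
    (by norm_num) one_pos (by norm_num) (by norm_num) hΔn hbn hcn (by norm_num) (by norm_num) hVH hEh.2 (by norm_num)
    (by norm_num [faceU, fsD, fsN, cA]) (by norm_num [faceU, fsD, fsN, cA]) (by norm_num [faceU, fsD, fsN, cA]) (by norm_num [faceU, fsD, fsN, cA])
    hER.1 (by norm_num) hEv.1 (by norm_num) (by norm_num) (by norm_num [faceG])
    (by norm_num [dWeightFaceCF, faceN, faceR, fsN]) (by norm_num [dWeightFaceCF, faceN, faceR, fsN])

/-- **`emeryBoxLa214v123 ∩ {Δ_pd ∈ [1.7, 2.91]} (DFT-level Δ tag)`, ν = 7/16: for EVERY member θ the Cu-d weight of the antinodal Fermi-surface state lies in `[0.6449, 0.7767]`** (hull of the 3 t_pd slab windows). [folklore] -/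
theorem la214DFTBox_dWeightFace_x0125 {Δ a b c : ℝ} (hΔ : Δ ∈ Icc ((17 : ℝ) / 10) ((291 : ℝ) / 100)) (ha : a ∈ Icc ((129 : ℝ) / 100) ((38 : ℝ) / 25)) (hb : b ∈ Icc ((23 : ℝ) / 50) ((33 : ℝ) / 50)) (hc : c ∈ Icc ((3 : ℝ) / 25) ((3 : ℝ) / 20)) :
    dWeightFace Δ a b c (fermiEnergyOf Δ a b c ((7 : ℝ) / 16)) ∈ Icc ((6449 : ℝ) / 10000) ((7767 : ℝ) / 10000) := by
  rcases le_or_gt a ((137 : ℝ) / 100) with h1 | h1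
  · have h := la214DFTBox_dWeightFace_x0125_s1 hΔ ⟨ha.1, h1⟩ hb hc
    exact ⟨le_trans (by norm_num) h.1, le_trans h.2 (by norm_num)⟩
  · rcases le_or_gt a ((29 : ℝ) / 20) with h2 | h2
    · have h := la214DFTBox_dWeightFace_x0125_s2 hΔ ⟨h1.le, h2⟩ hb hc
      exact ⟨le_trans (by norm_num) h.1, le_trans h.2 (by norm_num)⟩
    · have h := la214DFTBox_dWeightFace_x0125_s3 hΔ ⟨h2.le, ha.2⟩ hb hc
      exact ⟨le_trans (by norm_num) h.1, le_trans h.2 (by norm_num)⟩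

end Summit.Ventures.CertifiedManyBodySolver.Downfold.Emery
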